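import Mathlib

/-!
# Crux `ExactCertificate` (stmt-AtomisticToContinuum-11959), line `closure-makes-nogap-exact`,
# skeleton IX (`FarSlackActive`): stub `stub_remScaling` (F5)

Support file for the crux `ThreeConeCertificate.ExactCertificate`, skeleton IX
(`Cruxes.ExactCertificate.FarEqual.FarSlackActive`: the slack cone of an exact three-cone
certificate is active beyond every radius).  That skeleton shows that the cosine transform of a
power tail `σ ↦ ∫_ρ^∞ x^{-N} cos (σ x) dx`, `N = 2n + 2`, is (for `σ > 0`) the restriction of an
entire function, by writing `cos = T_n + R_n` with `T_n` the Taylor polynomial of degree `2n` and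
SCALING the absolutely convergent full remainder integral.  This file supplies the scaling step:
with `T_n(y) = Σ_{k ≤ n} (-1)^k y^{2k} / (2k)!`,

* `u ↦ u^{-N} (cos u − T_n u)` is integrable on `(0, ∞)`: on `(0, 1]` it is bounded by `e`
  (the Taylor remainder bound `|cos u − T_n u| ≤ |u|^N e^{|u|} / N!`, which is the hypothesis —
  the statement of the neighbouring stub `stub_cosTaylorBounds`, specialised to real arguments),
  and on `[1, ∞)` by `(n + 2) u^{-2}` (`|cos| ≤ 1`, `|T_n u| ≤ (n + 1) u^{2n}` for `u ≥ 1`);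
* for `σ ≠ 0`, `x ↦ x^{-N} (cos (σ x) − T_n (σ x))` is integrable on `(0, ∞)` and its integral is
  `|σ|^{N-1}` times the previous one: the remainder is even, so the integrand equals
  `|σ|^N g(|σ| x)` with `g u = u^{-N} (cos u − T_n u)`, and the substitution `u = |σ| x`
  (`MeasureTheory.integral_comp_mul_left_Ioi`, `MeasureTheory.integrableOn_Ioi_comp_mul_left_iff`)
  gives the factor `|σ|^N · |σ|⁻¹ = |σ|^{2n+1}`.

The helper lemmas are stated for an abstract `T : ℝ → ℝ` together with the hypothesis
`hT : ∀ y, T y = Σ_{k ≤ n} (-1)^k y^{2k} / (2k)!`, and the registered statement is the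
specialisation `T := fun y ↦ Σ …` (definitionally).  Pure Mathlib
(`Measure.integrableOn_of_bounded`, `integrableOn_Ioi_rpow_of_lt`, `Integrable.mono'`,
`Set.Ioc_union_Ioi_eq_Ioi`, `integral_const_mul`); private helper lemmas only, no definitions,
no named facts.  All `[folklore]`.
-/

noncomputable section

namespace Summit.AtomisticToContinuum.Crystallization.Theorems.ThreeConeCertificateExactCertificate.FarEqual

open MeasureTheory Set
open scoped BigOperators

/-- The Taylor polynomial `T_n` of `cos` is measurable (it is a polynomial). [folklore] -/
private theorem measurable_T (n : ℕ) {T : ℝ → ℝ}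
    (hT : ∀ y, T y = ∑ k ∈ Finset.range (n + 1), (-1 : ℝ) ^ k * y ^ (2 * k) / ((2 * k).factorial : ℝ)) :
    Measurable T := by
  rw [show T = fun y => ∑ k ∈ Finset.range (n + 1), (-1 : ℝ) ^ k * y ^ (2 * k) / ((2 * k).factorial : ℝ)
    from funext hT]
  fun_prop

/-- The Taylor polynomial `T_n` of `cos` is even: `T_n (-y) = T_n y`. [folklore] -/
private theorem T_neg (n : ℕ) {T : ℝ → ℝ}
    (hT : ∀ y, T y = ∑ k ∈ Finset.range (n + 1), (-1 : ℝ) ^ k * y ^ (2 * k) / ((2 * k).factorial : ℝ))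
    (y : ℝ) : T (-y) = T y := by
  rw [hT, hT]
  simp only [pow_mul, neg_sq]

/-- Real form of the complex Taylor remainder bound for `cos`:
`|cos u − T_n u| ≤ |u|^{2n+2} e^{|u|} / (2n+2)!`. [folklore] -/
private theorem abs_cos_sub_T_le (n : ℕ) {T : ℝ → ℝ}
    (hT : ∀ y, T y = ∑ k ∈ Finset.range (n + 1), (-1 : ℝ) ^ k * y ^ (2 * k) / ((2 * k).factorial : ℝ))
    (hcos : ∀ (n : ℕ) (y : ℂ),
      ‖Complex.cos y - ∑ k ∈ Finset.range (n + 1), (-1 : ℂ) ^ k * y ^ (2 * k) / ((2 * k).factorial : ℂ)‖ ≤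
        ‖y‖ ^ (2 * n + 2) * Real.exp ‖y‖ / ((2 * n + 2).factorial : ℝ))
    (u : ℝ) :
    |Real.cos u - T u| ≤ |u| ^ (2 * n + 2) * Real.exp |u| / ((2 * n + 2).factorial : ℝ) := by
  have h := hcos n u
  have hc : Complex.cos (u : ℂ) -
      ∑ k ∈ Finset.range (n + 1), (-1 : ℂ) ^ k * (u : ℂ) ^ (2 * k) / ((2 * k).factorial : ℂ) =
        ((Real.cos u - T u : ℝ) : ℂ) := by
    rw [hT]
    push_cast
    rfl
  rw [hc, Complex.norm_real, Complex.norm_real, Real.norm_eq_abs, Real.norm_eq_abs] at h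
  exact h

/-- On `(0, 1]` the scaled remainder is bounded: `|u^{-(2n+2)} (cos u − T_n u)| ≤ e`.
[folklore] -/
private theorem abs_rem_le_exp_one (n : ℕ) {T : ℝ → ℝ}
    (hT : ∀ y, T y = ∑ k ∈ Finset.range (n + 1), (-1 : ℝ) ^ k * y ^ (2 * k) / ((2 * k).factorial : ℝ))
    (hcos : ∀ (n : ℕ) (y : ℂ),
      ‖Complex.cos y - ∑ k ∈ Finset.range (n + 1), (-1 : ℂ) ^ k * y ^ (2 * k) / ((2 * k).factorial : ℂ)‖ ≤
        ‖y‖ ^ (2 * n + 2) * Real.exp ‖y‖ / ((2 * n + 2).factorial : ℝ))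
    {u : ℝ} (hu : 0 < u) (hu1 : u ≤ 1) :
    |(u ^ (2 * n + 2))⁻¹ * (Real.cos u - T u)| ≤ Real.exp 1 := by
  have hN : 0 < u ^ (2 * n + 2) := pow_pos hu _
  have hR := abs_cos_sub_T_le n hT hcos u
  rw [abs_of_pos hu] at hR
  rw [abs_mul, abs_inv, abs_of_pos hN]
  calc (u ^ (2 * n + 2))⁻¹ * |Real.cos u - T u|
      ≤ (u ^ (2 * n + 2))⁻¹ * (u ^ (2 * n + 2) * Real.exp u / ((2 * n + 2).factorial : ℝ)) := by
        gcongr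
    _ = Real.exp u / ((2 * n + 2).factorial : ℝ) := by
        field_simp
    _ ≤ Real.exp u :=
        div_le_self (Real.exp_pos u).le (Nat.one_le_cast.2 (Nat.factorial_pos _))
    _ ≤ Real.exp 1 := Real.exp_le_exp.2 hu1

/-- For `u ≥ 1` the Taylor polynomial is crudely bounded by its top power:
`|T_n u| ≤ (n + 1) u^{2n}`. [folklore] -/
private theorem abs_T_le (n : ℕ) {T : ℝ → ℝ}
    (hT : ∀ y, T y = ∑ k ∈ Finset.range (n + 1), (-1 : ℝ) ^ k * y ^ (2 * k) / ((2 * k).factorial : ℝ))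
    {u : ℝ} (hu : 1 ≤ u) : |T u| ≤ (n + 1) * u ^ (2 * n) := by
  have hu0 : 0 ≤ u := zero_le_one.trans hu
  rw [hT]
  calc |∑ k ∈ Finset.range (n + 1), (-1 : ℝ) ^ k * u ^ (2 * k) / ((2 * k).factorial : ℝ)|
      ≤ ∑ k ∈ Finset.range (n + 1), |(-1 : ℝ) ^ k * u ^ (2 * k) / ((2 * k).factorial : ℝ)| :=
        Finset.abs_sum_le_sum_abs _ _
    _ ≤ ∑ k ∈ Finset.range (n + 1), u ^ (2 * n) := by
        refine Finset.sum_le_sum fun k hk => ?_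
        have hk' : k ≤ n := Nat.lt_succ_iff.mp (Finset.mem_range.mp hk)
        rw [abs_div, abs_mul, abs_pow, abs_pow, abs_neg, abs_one, one_pow, one_mul, Nat.abs_cast,
          abs_of_nonneg hu0]
        calc u ^ (2 * k) / ((2 * k).factorial : ℝ) ≤ u ^ (2 * k) :=
              div_le_self (pow_nonneg hu0 _) (Nat.one_le_cast.2 (Nat.factorial_pos _))
          _ ≤ u ^ (2 * n) := pow_le_pow_right₀ hu (by omega)
    _ = (n + 1) * u ^ (2 * n) := by
        rw [Finset.sum_const, Finset.card_range, nsmul_eq_mul, Nat.cast_add, Nat.cast_one]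

/-- On `[1, ∞)` the scaled remainder decays like `u^{-2}`:
`|u^{-(2n+2)} (cos u − T_n u)| ≤ (n + 2) u^{-2}`. [folklore] -/
private theorem abs_rem_le_of_one_le (n : ℕ) {T : ℝ → ℝ}
    (hT : ∀ y, T y = ∑ k ∈ Finset.range (n + 1), (-1 : ℝ) ^ k * y ^ (2 * k) / ((2 * k).factorial : ℝ))
    {u : ℝ} (hu : 1 ≤ u) :
    |(u ^ (2 * n + 2))⁻¹ * (Real.cos u - T u)| ≤ ((n : ℝ) + 2) * (u ^ 2)⁻¹ := by
  have hu0 : 0 < u := one_pos.trans_le hu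
  have hR : |Real.cos u - T u| ≤ ((n : ℝ) + 2) * u ^ (2 * n) := by
    calc |Real.cos u - T u| ≤ |Real.cos u| + |T u| := abs_sub _ _
      _ ≤ 1 + (n + 1) * u ^ (2 * n) := add_le_add (Real.abs_cos_le_one u) (abs_T_le n hT hu)
      _ ≤ u ^ (2 * n) + (n + 1) * u ^ (2 * n) := by
          gcongr
          exact one_le_pow₀ hu
      _ = ((n : ℝ) + 2) * u ^ (2 * n) := by ring
  rw [abs_mul, abs_inv, abs_of_pos (pow_pos hu0 _)]
  calc (u ^ (2 * n + 2))⁻¹ * |Real.cos u - T u|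
      ≤ (u ^ (2 * n + 2))⁻¹ * (((n : ℝ) + 2) * u ^ (2 * n)) := by gcongr
    _ = ((n : ℝ) + 2) * (u ^ 2)⁻¹ := by
        rw [pow_add]
        field_simp

/-- The scaled remainder `u ↦ u^{-(2n+2)} (cos u − T_n u)` is integrable on `(0, ∞)`: bounded on
the finite-measure piece `(0, 1]`, dominated by `(n + 2) u^{-2}` on `(1, ∞)`. [folklore] -/
private theorem integrableOn_rem (n : ℕ) {T : ℝ → ℝ}
    (hT : ∀ y, T y = ∑ k ∈ Finset.range (n + 1), (-1 : ℝ) ^ k * y ^ (2 * k) / ((2 * k).factorial : ℝ))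
    (hcos : ∀ (n : ℕ) (y : ℂ),
      ‖Complex.cos y - ∑ k ∈ Finset.range (n + 1), (-1 : ℂ) ^ k * y ^ (2 * k) / ((2 * k).factorial : ℂ)‖ ≤
        ‖y‖ ^ (2 * n + 2) * Real.exp ‖y‖ / ((2 * n + 2).factorial : ℝ)) :
    IntegrableOn (fun u : ℝ => (u ^ (2 * n + 2))⁻¹ * (Real.cos u - T u)) (Ioi 0) := by
  have hTm : Measurable T := measurable_T n hT
  have hmeas : Measurable (fun u : ℝ => (u ^ (2 * n + 2))⁻¹ * (Real.cos u - T u)) := by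
    fun_prop
  rw [← Ioc_union_Ioi_eq_Ioi zero_le_one]
  refine IntegrableOn.union ?_ ?_
  · refine Measure.integrableOn_of_bounded (M := Real.exp 1) measure_Ioc_lt_top.ne
      hmeas.aestronglyMeasurable ?_
    exact (ae_restrict_mem measurableSet_Ioc).mono fun u hu => by
      rw [Real.norm_eq_abs]
      exact abs_rem_le_exp_one n hT hcos hu.1 hu.2
  · have hint : IntegrableOn (fun u : ℝ => ((n : ℝ) + 2) * u ^ (-2 : ℝ)) (Ioi 1) :=
      (integrableOn_Ioi_rpow_of_lt (by norm_num) zero_lt_one).const_mul _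
    refine Integrable.mono' hint hmeas.aestronglyMeasurable ?_
    exact (ae_restrict_mem measurableSet_Ioi).mono fun u hu => by
      have hu1 : 1 < u := hu
      rw [Real.norm_eq_abs, Real.rpow_neg (zero_le_one.trans hu1.le), Real.rpow_two]
      exact abs_rem_le_of_one_le n hT hu1.le

/-- The scaling law for an abstract `T` satisfying the Taylor-polynomial formula: integrability of
`u ↦ u^{-(2n+2)} (cos u − T u)` on `(0, ∞)`, integrability of `x ↦ x^{-(2n+2)} (cos (σ x) − T (σ x))`
for `σ ≠ 0`, and `∫_0^∞ x^{-(2n+2)} (cos (σ x) − T (σ x)) dx = |σ|^{2n+1} ∫_0^∞ u^{-(2n+2)} (cos u − T u) du`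
(evenness of the remainder and the substitution `u = |σ| x`). [folklore] -/
private theorem remScaling_of (n : ℕ) {T : ℝ → ℝ}
    (hT : ∀ y, T y = ∑ k ∈ Finset.range (n + 1), (-1 : ℝ) ^ k * y ^ (2 * k) / ((2 * k).factorial : ℝ))
    (hcos : ∀ (n : ℕ) (y : ℂ),
      ‖Complex.cos y - ∑ k ∈ Finset.range (n + 1), (-1 : ℂ) ^ k * y ^ (2 * k) / ((2 * k).factorial : ℂ)‖ ≤
        ‖y‖ ^ (2 * n + 2) * Real.exp ‖y‖ / ((2 * n + 2).factorial : ℝ)) :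
    IntegrableOn (fun u : ℝ => (u ^ (2 * n + 2))⁻¹ * (Real.cos u - T u)) (Ioi 0) ∧
      ∀ σ : ℝ, σ ≠ 0 →
        IntegrableOn (fun x : ℝ => (x ^ (2 * n + 2))⁻¹ * (Real.cos (σ * x) - T (σ * x))) (Ioi 0) ∧
          ∫ x in Ioi 0, (x ^ (2 * n + 2))⁻¹ * (Real.cos (σ * x) - T (σ * x)) =
            |σ| ^ (2 * n + 1) * ∫ u in Ioi 0, (u ^ (2 * n + 2))⁻¹ * (Real.cos u - T u) := by
  have hg := integrableOn_rem n hT hcos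
  refine ⟨hg, fun σ hσ => ?_⟩
  have habs : 0 < |σ| := abs_pos.2 hσ
  have hσN : |σ| ^ (2 * n + 2) ≠ 0 := pow_ne_zero _ habs.ne'
  -- the integrand is `|σ|^N g (|σ| x)` with `g u = u^{-N} (cos u - T u)` (evenness of the remainder)
  have hfun : (fun x : ℝ => (x ^ (2 * n + 2))⁻¹ * (Real.cos (σ * x) - T (σ * x))) =
      fun x => |σ| ^ (2 * n + 2) * (((|σ| * x) ^ (2 * n + 2))⁻¹ * (Real.cos (|σ| * x) - T (|σ| * x))) := by
    funext x
    have hR : Real.cos (σ * x) - T (σ * x) = Real.cos (|σ| * x) - T (|σ| * x) := by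
      rcases abs_choice σ with h | h
      · rw [h]
      · rw [h, neg_mul, Real.cos_neg, T_neg n hT]
    rw [hR, mul_pow, mul_inv, ← mul_assoc, ← mul_assoc, mul_inv_cancel₀ hσN, one_mul]
  -- substitution `u = |σ| x`
  have hcomp : IntegrableOn
      (fun x : ℝ => ((|σ| * x) ^ (2 * n + 2))⁻¹ * (Real.cos (|σ| * x) - T (|σ| * x))) (Ioi 0) :=
    (integrableOn_Ioi_comp_mul_left_iff (fun u : ℝ => (u ^ (2 * n + 2))⁻¹ * (Real.cos u - T u)) 0
      habs).2 (by rwa [mul_zero])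
  have hsub : ∫ x in Ioi 0, ((|σ| * x) ^ (2 * n + 2))⁻¹ * (Real.cos (|σ| * x) - T (|σ| * x)) =
      |σ|⁻¹ • ∫ u in Ioi (|σ| * 0), (u ^ (2 * n + 2))⁻¹ * (Real.cos u - T u) :=
    integral_comp_mul_left_Ioi (fun u : ℝ => (u ^ (2 * n + 2))⁻¹ * (Real.cos u - T u)) 0 habs
  refine ⟨?_, ?_⟩
  · rw [hfun]
    exact hcomp.const_mul _
  · rw [hfun, integral_const_mul, hsub, mul_zero, smul_eq_mul, ← mul_assoc, pow_succ,
      mul_assoc (|σ| ^ (2 * n + 1)), mul_inv_cancel₀ habs.ne', mul_one]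

/-- Stub F5 (scaling of the full remainder integral): given the Taylor remainder bounds F3,
`u ↦ u^{−(2n+2)}(cos u − T_n u)` is integrable on `(0, ∞)`, and for `σ ≠ 0` so is
`x ↦ x^{−(2n+2)}(cos(σx) − T_n(σx))`, with
`∫_0^∞ x^{−(2n+2)}(cos(σx) − T_n(σx))dx = |σ|^{2n+1} ∫_0^∞ u^{−(2n+2)}(cos u − T_n u)du`
(the remainder is even; substitution `u = |σ|x`). [folklore] -/
theorem stub_remScaling : (∀ (n : ℕ) (y : ℂ),
      ‖Complex.cos y - ∑ k ∈ Finset.range (n + 1), (-1 : ℂ) ^ k * y ^ (2 * k) / ((2 * k).factorial : ℂ)‖ ≤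
          ‖y‖ ^ (2 * n + 2) * Real.exp ‖y‖ / ((2 * n + 2).factorial : ℝ) ∧
        ‖Complex.sin y - ∑ k ∈ Finset.range n, (-1 : ℂ) ^ k * y ^ (2 * k + 1) / ((2 * k + 1).factorial : ℂ)‖ ≤
          ‖y‖ ^ (2 * n + 1) * Real.exp ‖y‖ / ((2 * n + 1).factorial : ℝ) ∧
        HasDerivAt (fun w : ℂ => Complex.cos w - ∑ k ∈ Finset.range (n + 1), (-1 : ℂ) ^ k * w ^ (2 * k) / ((2 * k).factorial : ℂ))
          (-(Complex.sin y - ∑ k ∈ Finset.range n, (-1 : ℂ) ^ k * y ^ (2 * k + 1) / ((2 * k + 1).factorial : ℂ))) y) →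
    ∀ n : ℕ, MeasureTheory.IntegrableOn (fun u : ℝ => (u ^ (2 * n + 2))⁻¹ * (Real.cos u - ∑ k ∈ Finset.range (n + 1), (-1 : ℝ) ^ k * u ^ (2 * k) / ((2 * k).factorial : ℝ))) (Set.Ioi 0) ∧
        ∀ σ : ℝ, σ ≠ 0 → MeasureTheory.IntegrableOn (fun x : ℝ => (x ^ (2 * n + 2))⁻¹ * (Real.cos (σ * x) - ∑ k ∈ Finset.range (n + 1), (-1 : ℝ) ^ k * (σ * x) ^ (2 * k) / ((2 * k).factorial : ℝ))) (Set.Ioi 0) ∧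
          ∫ x in Set.Ioi 0, (x ^ (2 * n + 2))⁻¹ * (Real.cos (σ * x) - ∑ k ∈ Finset.range (n + 1), (-1 : ℝ) ^ k * (σ * x) ^ (2 * k) / ((2 * k).factorial : ℝ)) =
            |σ| ^ (2 * n + 1) * ∫ u in Set.Ioi 0, (u ^ (2 * n + 2))⁻¹ * (Real.cos u - ∑ k ∈ Finset.range (n + 1), (-1 : ℝ) ^ k * u ^ (2 * k) / ((2 * k).factorial : ℝ)) := by
  intro hF3 n
  exact remScaling_of n
    (T := fun y => ∑ k ∈ Finset.range (n + 1), (-1 : ℝ) ^ k * y ^ (2 * k) / ((2 * k).factorial : ℝ))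
    (fun _ => rfl) fun m y => (hF3 m y).1

end Summit.AtomisticToContinuum.Crystallization.Theorems.ThreeConeCertificateExactCertificate.FarEqual
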